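import Summits.BirchSwinnertonDyer.BirchSwinnertonDyer.Theorems.SmallImageMuTransferMuTransferStubX9GraphPairing
import Summits.BirchSwinnertonDyer.BirchSwinnertonDyer.Theorems.SmallImageMuTransferMuTransferX9StepOneOperators
import Summits.BirchSwinnertonDyer.BirchSwinnertonDyer.Theorems.SmallImageMuTransferMuTransferX9StepOneDual
import Summits.BirchSwinnertonDyer.BirchSwinnertonDyer.Theorems.SmallImageMuTransferMuTransferX9StepOneDualOdd
import Summits.BirchSwinnertonDyer.BirchSwinnertonDyer.Theorems.SmallImageMuTransferMuTransferX9StepOneImages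
import Summits.BirchSwinnertonDyer.BirchSwinnertonDyer.Theorems.SmallImageMuTransferMuTransferX9TopGenerator
import Literature.NumberTheory.EllipticCurves.KummerImageIsotropy
import Literature.NumberTheory.GaloisCohomology.ArchimedeanInvariantMap
import HarnessLib

/-!
# K6 crux `MuTransferX9` (stmt-BirchSwinnertonDyer-19276), skeleton v5: STEP 1 + LEMMA 4 of
# MU-TRANSFER-PROOF §§4–5 on the genuine objects — a joint value of the two test classes whose two lowest
# Weil-pairing convolution coefficients do not both vanish

Cell `bsd-smallim`, seat `bsd-smallim-k6-c2` (gen 3). HONEST FRAMING: theorems only (no definition, no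
named fact, no `sorry`); nothing is asserted about any curve and nothing is booked. Serves the registered
BC3 skeleton v5 (sha16 bbfcbeb8eb041500) of crux 19276 — it is the Step-1/Lemma-4 block of the kernel
composition `stub_coreX9_of` (sibling `…X9CoreAssembly.lean`), isolated so that the `ZMod p`-linear
repackaging (`AddSubgroup.toZModSubmodule`, `AddMonoidHom.toZModLinearMap`, `μ_p ≃+ ℤ/p` by
`muCarrierZModEquiv`) happens once:

* `exists_jointValue_weil_ne_zero` — for `(E, p) ∈ X9`, `κ' ∈ 𝐇¹_Ω(E[p])` with `κ̄' ≠ 0` (Step 0), a cocycle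
  `φ` of `κ'_e`, a cocycle `ψ` of a class of the dual twist `𝒯_e(E, κ⁻¹)` with `T^{e−1}[ψ] ≠ 0`
  (`e = e' + 1 ≥ 2`) and a Weil pairing `e_W` (any witness of `exists_weilPairing`): some joint value
  `z = (φ τ, ψ τ)` with `τ` in the joint kernel `N_e(κ) ⊓ N_e(κ⁻¹)` satisfies `e_W(z₁(0), z₂(0)) ≠ 0` or
  `e_W(z₁(0), z₂(1)) + e_W(z₁(1), z₂(0)) ≠ 0`.  Ingredients: STEP 1 on both sides
  (`LevelE.valueSubgroup_inf_eq_top_of_towerConst_ne_zero`, `…_of_shiftH1_iterate_ne_zero`, p441592), the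
  joint value module `contOneCocycles.jointValueSubgroup` (p437287) is `Γ_ℚ`-stable hence `(γ₀ − 1)`-stable
  for x9 g41's topological generator `γ₀` fixing `E[p]` (`ClassX9.exists_isTopGenerator_forall_smul_eq`),
  whose coordinates are the schema's `(T, D)` (`LevelE.twistModP_sub_apply_zero/one`,
  `LevelE.invTwist_twistModP_sub_apply_zero/one`, p436931), and LEMMA 4 by polarisation
  (`LevelE.exists_mem_pairingCoeff_ne_zero`, p419785) over `k = ZMod p` (`2 ≠ 0` as `p ≥ 5`), the Weil pairing
  being non-degenerate.

PARTITION (D-0054): X9 (A4) × p ∈ {5,7} — helper toward `stub_coreX9`; closes none.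

References: HOME/koly/MU-TRANSFER-PROOF.md §4 Lemma 4, §5 STEP 1; B. Mazur, K. Rubin, Mem. AMS 799 (2004)
§5.3 [MazurRubin2004]; J.-P. Serre, Invent. Math. 15 (1972) §2.4 Prop. 15 [Serre1972]; J. H. Silverman,
*AEC* III.8.1 [SilvermanAEC2009].
-/

set_option linter.dupNamespace false
set_option autoImplicit false

noncomputable section

open scoped Classical NumberField
open WeierstrassCurve Field IsDedekindDomain
open Literature.NumberTheory.GaloisRepresentations
open Literature.NumberTheory.GaloisCohomology
open Literature.NumberTheory.EllipticCurves
open Summit.BirchSwinnertonDyer.BirchSwinnertonDyer.Rank1Residual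

namespace Summit.BirchSwinnertonDyer.BirchSwinnertonDyer.Rank1Residual.CoreAssembly

/-! ## STEP 1 + LEMMA 4 on the genuine objects -/

/-- **MU-TRANSFER-PROOF §5 STEP 1 with §4 LEMMA 4, on class X9.**  For `κ' ∈ 𝐇¹_Ω` with `κ̄' ≠ 0`
(Step 0), a cocycle `φ` of `κ'_e`, a cocycle `ψ` of a class of the dual twist `𝒯_e(E, κ⁻¹)` with
`T^{e−1}[ψ] ≠ 0`, and a Weil pairing `e_W`: some joint value `z = (φ τ, ψ τ)`, `τ` in the joint kernel
`N_e(κ) ⊓ N_e(κ⁻¹)`, has `e_W(z₁(0), z₂(0)) ≠ 0` or `e_W(z₁(0), z₂(1)) + e_W(z₁(1), z₂(0)) ≠ 0` — the two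
lowest coefficients of `⟨z₁, z₂⟩_{A_e}` do not both vanish.  (Step 1: both value groups are everything,
`valueSubgroup_inf_eq_top_of_towerConst_ne_zero` / `…_of_shiftH1_iterate_ne_zero`; the joint value module
is `(γ₀ − 1)`-stable for x9 g41's `γ₀` fixing `E[p]`; Lemma 4 = `exists_mem_pairingCoeff_ne_zero` over
`k = ZMod p`, the Weil pairing read in `ℤ/p` through `μ_p ≃ ℤ/p`.)
[cite: MazurRubin2004, §5.3] [cite: Serre1972, §2.4 Prop. 15] [cite: SilvermanAEC2009, Prop. III.8.1] -/
theorem exists_jointValue_weil_ne_zero (W : WeierstrassCurve ℚ) [W.IsElliptic] [W.IsGloballyMinimal]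
    (p : ℕ) [Fact p.Prime] (κ : ZpExtension ℚ p) {γ : absoluteGaloisGroup ℚ}
    (hX9 : Summit.BirchSwinnertonDyer.BirchSwinnertonDyer.Rank1Residual.ClassX9 W p)
    (hγ : κ.IsTopGenerator γ)
    (κ' : κ.twistTower (W.torsionGaloisModule (p : ℤ))
      (fun P : WeierstrassCurve.geomTorsion W (p : ℤ) => AddSubgroup.torsionBy.nsmul P))
    (hκ'c : κ.towerConst (W.torsionGaloisModule (p : ℤ)) (fun P => AddSubgroup.torsionBy.nsmul P) κ' ≠ 0)
    {e' : ℕ} (he1 : 1 < e' + 1) (φ : contOneCocycles (W.modPTwist p κ (e' + 1)).toTopRep)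
    (hφ : oneCocycleClass (W.modPTwist p κ (e' + 1)).toTopRep φ = κ'.1 (e' + 1))
    (ψ : contOneCocycles (W.modPTwist p κ.invTwist (e' + 1)).toTopRep)
    (hψT : (κ.invTwist.shiftH1 (W.torsionGaloisModule (p : ℤ))
      (fun P : WeierstrassCurve.geomTorsion W (p : ℤ) => AddSubgroup.torsionBy.nsmul P) (e' + 1))^[e']
        (oneCocycleClass (W.modPTwist p κ.invTwist (e' + 1)).toTopRep ψ) ≠ 0)
    (eW : WeierstrassCurve.geomTorsion W (p : ℤ) → WeierstrassCurve.geomTorsion W (p : ℤ) →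
      AlgebraicClosure ℚ)
    (hμ : ∀ S T, eW S T ^ p = 1) (hadd₁ : ∀ S₁ S₂ T, eW (S₁ + S₂) T = eW S₁ T * eW S₂ T)
    (hadd₂ : ∀ S T₁ T₂, eW S (T₁ + T₂) = eW S T₁ * eW S T₂) (hnondeg : ∀ T, (∀ S, eW S T = 1) → T = 0) :
    haveI : NeZero p := ⟨(Fact.out : p.Prime).ne_zero⟩
    ∃ z ∈ contOneCocycles.jointValueSubgroup φ ψ
      ((κ.twistModPRepresentation (W.torsionGaloisModule (p : ℤ))
          (fun P : WeierstrassCurve.geomTorsion W (p : ℤ) => AddSubgroup.torsionBy.nsmul P) (e' + 1)).ker ⊓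
        (κ.invTwist.twistModPRepresentation (W.torsionGaloisModule (p : ℤ))
          (fun P : WeierstrassCurve.geomTorsion W (p : ℤ) => AddSubgroup.torsionBy.nsmul P) (e' + 1)).ker)
      (fun _ hτ x => κ.toTopRep_ρ_apply_eq_self_of_mem_ker (W.torsionGaloisModule (p : ℤ)) _ (e' + 1)
        (Subgroup.mem_inf.mp hτ).1 x)
      (fun _ hτ y => κ.invTwist.toTopRep_ρ_apply_eq_self_of_mem_ker (W.torsionGaloisModule (p : ℤ)) _
        (e' + 1) (Subgroup.mem_inf.mp hτ).2 y),
      weilPairingHom W p eW hμ hadd₁ hadd₂ (z.1 ⟨0, by omega⟩) (z.2 ⟨0, by omega⟩) ≠ 0 ∨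
      weilPairingHom W p eW hμ hadd₁ hadd₂ (z.1 ⟨0, by omega⟩) (z.2 ⟨1, he1⟩) +
        weilPairingHom W p eW hμ hadd₁ hadd₂ (z.1 ⟨1, he1⟩) (z.2 ⟨0, by omega⟩) ≠ 0 := by
  have hp : p.Prime := Fact.out
  obtain ⟨hnoCM, hp5, hgood, hap, hirr, hns⟩ := hX9
  haveI : Finite (WeierstrassCurve.geomTorsion W (p : ℤ)) :=
    WeierstrassCurve.finite_torsionPoints_holds W (AlgebraicClosure ℚ) (by exact_mod_cast hp.ne_zero)
  haveI : NeZero p := ⟨hp.ne_zero⟩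
  -- STEP 1 on both sides, on the joint kernel `H = N_e(κ) ⊓ N_e(κ⁻¹)`
  have hγ' : κ.invTwist.IsTopGenerator γ⁻¹ := LevelE.isTopGenerator_invTwist_inv κ hγ
  set H : Subgroup (absoluteGaloisGroup ℚ) :=
    (κ.twistModPRepresentation (W.torsionGaloisModule (p : ℤ))
        (fun P : WeierstrassCurve.geomTorsion W (p : ℤ) => AddSubgroup.torsionBy.nsmul P) (e' + 1)).ker ⊓
      (κ.invTwist.twistModPRepresentation (W.torsionGaloisModule (p : ℤ))
        (fun P : WeierstrassCurve.geomTorsion W (p : ℤ) => AddSubgroup.torsionBy.nsmul P) (e' + 1)).ker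
    with hHdef
  have hX : ∀ τ ∈ H, ∀ x : (W.modPTwist p κ (e' + 1)).toTopRep,
      (W.modPTwist p κ (e' + 1)).toTopRep.ρ τ x = x := fun _ hτ x =>
    κ.toTopRep_ρ_apply_eq_self_of_mem_ker (W.torsionGaloisModule (p : ℤ)) _ (e' + 1)
      (Subgroup.mem_inf.mp hτ).1 x
  have hY : ∀ τ ∈ H, ∀ y : (W.modPTwist p κ.invTwist (e' + 1)).toTopRep,
      (W.modPTwist p κ.invTwist (e' + 1)).toTopRep.ρ τ y = y := fun _ hτ y =>
    κ.invTwist.toTopRep_ρ_apply_eq_self_of_mem_ker (W.torsionGaloisModule (p : ℤ)) _ (e' + 1)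
      (Subgroup.mem_inf.mp hτ).2 y
  have hφtop : contOneCocycles.valueSubgroup φ H hX = ⊤ :=
    LevelE.valueSubgroup_inf_eq_top_of_towerConst_ne_zero W p κ κ.invTwist hp5 hirr hns hγ κ' hκ'c e'
      (e' + 1) φ hφ
  have hψtop : contOneCocycles.valueSubgroup ψ H hY = ⊤ :=
    LevelE.valueSubgroup_inf_eq_top_of_shiftH1_iterate_ne_zero W p κ κ.invTwist hp5 hirr hns hγ'
      (e' + 1) e' ψ hψT
  haveI hHn : H.Normal := by rw [hHdef]; infer_instance
  -- a topological generator `γ₀` fixing `E[p]` (x9 g41): `γ₀ − 1` is `(S, −S·U)` on the two twists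
  obtain ⟨γ₀, hγ₀, hγ₀E⟩ :=
    ClassX9.exists_isTopGenerator_forall_smul_eq W p κ ⟨hnoCM, hp5, hgood, hap, hirr, hns⟩
  -- the joint value module `M` and its `ZMod p`-linear repackaging
  classical
  letI : Module (ZMod p) (WeierstrassCurve.geomTorsion W (p : ℤ)) := AddSubgroup.torsionBy.zmodModule
  set Mj := contOneCocycles.jointValueSubgroup φ ψ H hX hY with hMjdef
  let Mk : Submodule (ZMod p)
      ((Fin (e' + 1) → WeierstrassCurve.geomTorsion W (p : ℤ)) ×
        (Fin (e' + 1) → WeierstrassCurve.geomTorsion W (p : ℤ))) :=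
    AddSubgroup.toZModSubmodule p Mj
  have hMkmem : ∀ z, z ∈ Mk ↔ z ∈ Mj := fun z => AddSubgroup.mem_toZModSubmodule p
  -- the operators `γ₀ − 1` on the two twists, as `ZMod p`-linear maps
  let T : (Fin (e' + 1) → WeierstrassCurve.geomTorsion W (p : ℤ)) →ₗ[ZMod p]
      (Fin (e' + 1) → WeierstrassCurve.geomTorsion W (p : ℤ)) :=
    ((W.modPTwist p κ (e' + 1) γ₀).toAddMonoidHom - AddMonoidHom.id _).toZModLinearMap p
  let D : (Fin (e' + 1) → WeierstrassCurve.geomTorsion W (p : ℤ)) →ₗ[ZMod p]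
      (Fin (e' + 1) → WeierstrassCurve.geomTorsion W (p : ℤ)) :=
    ((W.modPTwist p κ.invTwist (e' + 1) γ₀).toAddMonoidHom - AddMonoidHom.id _).toZModLinearMap p
  have hfix : ∀ x : Fin (e' + 1) → WeierstrassCurve.geomTorsion W (p : ℤ),
      (fun i => W.torsionGaloisModule (p : ℤ) γ₀ (x i)) = x := fun x =>
    funext fun i => by rw [WeierstrassCurve.torsionGaloisModule_apply_apply, hγ₀E]
  have hTapply : ∀ x, T x = W.modPTwist p κ (e' + 1) γ₀ x - fun i => W.torsionGaloisModule (p : ℤ) γ₀ (x i) :=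
    fun x => by rw [hfix]; rfl
  have hDapply : ∀ y, D y =
      W.modPTwist p κ.invTwist (e' + 1) γ₀ y - fun i => W.torsionGaloisModule (p : ℤ) γ₀ (y i) :=
    fun y => by rw [hfix]; rfl
  have hT0 : ∀ x, T x ⟨0, by omega⟩ = 0 := fun x => by
    rw [hTapply]; exact LevelE.twistModP_sub_apply_zero κ _ _ (e' + 1) hγ₀ (by omega) x
  have hT1 : ∀ x, T x ⟨1, he1⟩ = x ⟨0, by omega⟩ := fun x => by
    rw [hTapply]
    refine (LevelE.twistModP_sub_apply_one κ _ _ (e' + 1) hγ₀ he1 x).trans ?_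
    rw [WeierstrassCurve.torsionGaloisModule_apply_apply, hγ₀E]
  have hD0 : ∀ y, D y ⟨0, by omega⟩ = 0 := fun y => by
    rw [hDapply]; exact LevelE.invTwist_twistModP_sub_apply_zero κ _ _ (e' + 1) hγ₀ (by omega) y
  have hD1 : ∀ y, D y ⟨1, he1⟩ = -y ⟨0, by omega⟩ := fun y => by
    rw [hDapply]
    refine (LevelE.invTwist_twistModP_sub_apply_one κ _ _ (e' + 1) hγ₀ he1 y).trans ?_
    rw [WeierstrassCurve.torsionGaloisModule_apply_apply, hγ₀E]
  have hMkT : ∀ z ∈ Mk, (T z.1, D z.2) ∈ Mk := by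
    intro z hz
    rw [hMkmem] at hz ⊢
    have h1 := contOneCocycles.smul_mem_jointValueSubgroup φ ψ H hX hY γ₀ hz
    exact LevelE.sub_mem_of_prod_stable (W.modPTwist p κ (e' + 1) γ₀).toAddMonoidHom
      (W.modPTwist p κ.invTwist (e' + 1) γ₀).toAddMonoidHom Mj (fun w hw =>
        contOneCocycles.smul_mem_jointValueSubgroup φ ψ H hX hY γ₀ hw) hz
  have h1M : ∀ v : WeierstrassCurve.geomTorsion W (p : ℤ), ∃ z ∈ Mk, z.1 ⟨0, by omega⟩ = v := by
    intro v
    obtain ⟨z, hz, hz1⟩ := contOneCocycles.exists_mem_jointValueSubgroup_fst_eq φ ψ H hX hY hφtop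
      (fun i => if (i : ℕ) = 0 then v else 0)
    exact ⟨z, (hMkmem z).2 hz, by rw [hz1]; simp⟩
  have h2M : ∀ v : WeierstrassCurve.geomTorsion W (p : ℤ), ∃ z ∈ Mk, z.2 ⟨0, by omega⟩ = v := by
    intro v
    obtain ⟨z, hz, hz2⟩ := contOneCocycles.exists_mem_jointValueSubgroup_snd_eq φ ψ H hX hY hψtop
      (fun i => if (i : ℕ) = 0 then v else 0)
    exact ⟨z, (hMkmem z).2 hz, by rw [hz2]; simp⟩
  -- the Weil pairing as a `ZMod p`-valued bilinear form (`μ_p ≃ ℤ/p`), non-degenerate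
  haveI : NeZero p := ⟨hp.ne_zero⟩
  set eWH := weilPairingHom W p eW hμ hadd₁ hadd₂ with heWH
  set ι := muCarrierZModEquiv ℚ p with hι
  set evAdd : WeierstrassCurve.geomTorsion W (p : ℤ) →+ WeierstrassCurve.geomTorsion W (p : ℤ) →+ ZMod p :=
    eWH.flip.compr₂ ι.toAddMonoidHom with hevAdd
  let ev : WeierstrassCurve.geomTorsion W (p : ℤ) →ₗ[ZMod p]
      WeierstrassCurve.geomTorsion W (p : ℤ) →ₗ[ZMod p] ZMod p :=
    LinearMap.mk₂ (ZMod p) (fun y v => evAdd y v)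
      (fun y₁ y₂ v => by rw [evAdd.map_add]; rfl)
      (fun c y v => ZMod.map_smul (evAdd.flip v) c y)
      (fun y v₁ v₂ => (evAdd y).map_add v₁ v₂)
      (fun c y v => ZMod.map_smul (evAdd y) c v)
  have hev_apply : ∀ y v, ev y v = ι (eWH v y) := fun _ _ => rfl
  have hev : ∃ y v, ev y v ≠ 0 := by
    -- `E[p]` has a non-zero point (`#E[p] = p²`), and `e_W` is non-degenerate
    have hcard : 1 < Nat.card (WeierstrassCurve.geomTorsion W (p : ℤ)) := by
      rw [W.natCard_geomTorsion (n := (p : ℤ)) (by exact_mod_cast hp.ne_zero), Int.natAbs_natCast]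
      nlinarith [hp.one_lt]
    haveI := Finite.one_lt_card_iff_nontrivial.mp hcard
    obtain ⟨T₀, hT₀⟩ := exists_ne (0 : WeierstrassCurve.geomTorsion W (p : ℤ))
    have hS : ∃ S, eW S T₀ ≠ 1 := by
      by_contra h
      push Not at h
      exact hT₀ (hnondeg T₀ h)
    obtain ⟨S, hS⟩ := hS
    refine ⟨T₀, S, ?_⟩
    rw [hev_apply]
    intro h0
    apply hS
    have h1 : eWH S T₀ = 0 := ι.map_eq_zero_iff.mp h0
    rw [heWH, muCarrier_eq_iff, coe_weilPairingHom] at h1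
    exact h1
  -- LEMMA 4 (polarisation): a joint value pairing with `T`-valuation `≤ 1`
  have h2k : (2 : ZMod p) ≠ 0 := by
    have h : ((2 : ℕ) : ZMod p) ≠ 0 := by
      rw [Ne, ZMod.natCast_eq_zero_iff]
      intro hdvd
      have := Nat.le_of_dvd two_pos hdvd
      omega
    exact_mod_cast h
  obtain ⟨z, hzM, hz01⟩ := LevelE.exists_mem_pairingCoeff_ne_zero (e := e' + 1) h2k (by omega) ev hev T D
    hT0 hT1 hD0 hD1 Mk hMkT h1M h2M
  refine ⟨z, (hMkmem z).1 hzM, ?_⟩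
  rw [hev_apply, hev_apply, hev_apply, ← map_add] at hz01
  rcases hz01 with h0 | h1
  · exact Or.inl fun h => h0 (by rw [h, map_zero])
  · exact Or.inr fun h => h1 (by rw [add_comm, h, map_zero])

/-! ## The class-free (odd prime) form (skeleton v6) -/

/-- **The class-free form of `exists_jointValue_weil_ne_zero`** (`p ≠ 2`, `E[p]` irreducible, `ρ̄` not
onto — X9 at `p ≥ 5`, X10b∧¬Surj at `p = 3`): same statement and proof with the `_of_ne_two` Step-1 lemmas
and `exists_isTopGenerator_forall_smul_eq_of_irreducible_of_not_surjective`.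
[cite: MazurRubin2004, §5.3] [cite: Serre1972, §2.4 Prop. 15] [cite: SilvermanAEC2009, Prop. III.8.1] -/
theorem exists_jointValue_weil_ne_zero_of_ne_two (W : WeierstrassCurve ℚ) [W.IsElliptic]
    [W.IsGloballyMinimal] (p : ℕ) [Fact p.Prime] (κ : ZpExtension ℚ p) {γ : absoluteGaloisGroup ℚ}
    (hp2 : p ≠ 2) (hirr : W.HasIrreducibleModPGaloisRep p) (hns : ¬ W.HasSurjectiveModNGaloisRep p)
    (hγ : κ.IsTopGenerator γ)
    (κ' : κ.twistTower (W.torsionGaloisModule (p : ℤ))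
      (fun P : WeierstrassCurve.geomTorsion W (p : ℤ) => AddSubgroup.torsionBy.nsmul P))
    (hκ'c : κ.towerConst (W.torsionGaloisModule (p : ℤ)) (fun P => AddSubgroup.torsionBy.nsmul P) κ' ≠ 0)
    {e' : ℕ} (he1 : 1 < e' + 1) (φ : contOneCocycles (W.modPTwist p κ (e' + 1)).toTopRep)
    (hφ : oneCocycleClass (W.modPTwist p κ (e' + 1)).toTopRep φ = κ'.1 (e' + 1))
    (ψ : contOneCocycles (W.modPTwist p κ.invTwist (e' + 1)).toTopRep)
    (hψT : (κ.invTwist.shiftH1 (W.torsionGaloisModule (p : ℤ))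
      (fun P : WeierstrassCurve.geomTorsion W (p : ℤ) => AddSubgroup.torsionBy.nsmul P) (e' + 1))^[e']
        (oneCocycleClass (W.modPTwist p κ.invTwist (e' + 1)).toTopRep ψ) ≠ 0)
    (eW : WeierstrassCurve.geomTorsion W (p : ℤ) → WeierstrassCurve.geomTorsion W (p : ℤ) →
      AlgebraicClosure ℚ)
    (hμ : ∀ S T, eW S T ^ p = 1) (hadd₁ : ∀ S₁ S₂ T, eW (S₁ + S₂) T = eW S₁ T * eW S₂ T)
    (hadd₂ : ∀ S T₁ T₂, eW S (T₁ + T₂) = eW S T₁ * eW S T₂) (hnondeg : ∀ T, (∀ S, eW S T = 1) → T = 0) :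
    haveI : NeZero p := ⟨(Fact.out : p.Prime).ne_zero⟩
    ∃ z ∈ contOneCocycles.jointValueSubgroup φ ψ
      ((κ.twistModPRepresentation (W.torsionGaloisModule (p : ℤ))
          (fun P : WeierstrassCurve.geomTorsion W (p : ℤ) => AddSubgroup.torsionBy.nsmul P) (e' + 1)).ker ⊓
        (κ.invTwist.twistModPRepresentation (W.torsionGaloisModule (p : ℤ))
          (fun P : WeierstrassCurve.geomTorsion W (p : ℤ) => AddSubgroup.torsionBy.nsmul P) (e' + 1)).ker)
      (fun _ hτ x => κ.toTopRep_ρ_apply_eq_self_of_mem_ker (W.torsionGaloisModule (p : ℤ)) _ (e' + 1)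
        (Subgroup.mem_inf.mp hτ).1 x)
      (fun _ hτ y => κ.invTwist.toTopRep_ρ_apply_eq_self_of_mem_ker (W.torsionGaloisModule (p : ℤ)) _
        (e' + 1) (Subgroup.mem_inf.mp hτ).2 y),
      weilPairingHom W p eW hμ hadd₁ hadd₂ (z.1 ⟨0, by omega⟩) (z.2 ⟨0, by omega⟩) ≠ 0 ∨
      weilPairingHom W p eW hμ hadd₁ hadd₂ (z.1 ⟨0, by omega⟩) (z.2 ⟨1, he1⟩) +
        weilPairingHom W p eW hμ hadd₁ hadd₂ (z.1 ⟨1, he1⟩) (z.2 ⟨0, by omega⟩) ≠ 0 := by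
  have hp : p.Prime := Fact.out
  haveI : Finite (WeierstrassCurve.geomTorsion W (p : ℤ)) :=
    WeierstrassCurve.finite_torsionPoints_holds W (AlgebraicClosure ℚ) (by exact_mod_cast hp.ne_zero)
  haveI : NeZero p := ⟨hp.ne_zero⟩
  have hγ' : κ.invTwist.IsTopGenerator γ⁻¹ := LevelE.isTopGenerator_invTwist_inv κ hγ
  set H : Subgroup (absoluteGaloisGroup ℚ) :=
    (κ.twistModPRepresentation (W.torsionGaloisModule (p : ℤ))
        (fun P : WeierstrassCurve.geomTorsion W (p : ℤ) => AddSubgroup.torsionBy.nsmul P) (e' + 1)).ker ⊓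
      (κ.invTwist.twistModPRepresentation (W.torsionGaloisModule (p : ℤ))
        (fun P : WeierstrassCurve.geomTorsion W (p : ℤ) => AddSubgroup.torsionBy.nsmul P) (e' + 1)).ker
    with hHdef
  have hX : ∀ τ ∈ H, ∀ x : (W.modPTwist p κ (e' + 1)).toTopRep,
      (W.modPTwist p κ (e' + 1)).toTopRep.ρ τ x = x := fun _ hτ x =>
    κ.toTopRep_ρ_apply_eq_self_of_mem_ker (W.torsionGaloisModule (p : ℤ)) _ (e' + 1)
      (Subgroup.mem_inf.mp hτ).1 x
  have hY : ∀ τ ∈ H, ∀ y : (W.modPTwist p κ.invTwist (e' + 1)).toTopRep,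
      (W.modPTwist p κ.invTwist (e' + 1)).toTopRep.ρ τ y = y := fun _ hτ y =>
    κ.invTwist.toTopRep_ρ_apply_eq_self_of_mem_ker (W.torsionGaloisModule (p : ℤ)) _ (e' + 1)
      (Subgroup.mem_inf.mp hτ).2 y
  have hφtop : contOneCocycles.valueSubgroup φ H hX = ⊤ :=
    LevelE.valueSubgroup_inf_eq_top_of_towerConst_ne_zero_of_ne_two W p κ κ.invTwist hp2 hirr hns hγ κ'
      hκ'c e'
      (e' + 1) φ hφ
  have hψtop : contOneCocycles.valueSubgroup ψ H hY = ⊤ :=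
    LevelE.valueSubgroup_inf_eq_top_of_shiftH1_iterate_ne_zero_of_ne_two W p κ κ.invTwist hp2 hirr hns hγ'
      (e' + 1) e' ψ hψT
  haveI hHn : H.Normal := by rw [hHdef]; infer_instance
  obtain ⟨γ₀, hγ₀, hγ₀E⟩ :=
    exists_isTopGenerator_forall_smul_eq_of_irreducible_of_not_surjective W p κ hirr hns
  classical
  letI : Module (ZMod p) (WeierstrassCurve.geomTorsion W (p : ℤ)) := AddSubgroup.torsionBy.zmodModule
  set Mj := contOneCocycles.jointValueSubgroup φ ψ H hX hY with hMjdef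
  let Mk : Submodule (ZMod p)
      ((Fin (e' + 1) → WeierstrassCurve.geomTorsion W (p : ℤ)) ×
        (Fin (e' + 1) → WeierstrassCurve.geomTorsion W (p : ℤ))) :=
    AddSubgroup.toZModSubmodule p Mj
  have hMkmem : ∀ z, z ∈ Mk ↔ z ∈ Mj := fun z => AddSubgroup.mem_toZModSubmodule p
  let T : (Fin (e' + 1) → WeierstrassCurve.geomTorsion W (p : ℤ)) →ₗ[ZMod p]
      (Fin (e' + 1) → WeierstrassCurve.geomTorsion W (p : ℤ)) :=
    ((W.modPTwist p κ (e' + 1) γ₀).toAddMonoidHom - AddMonoidHom.id _).toZModLinearMap p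
  let D : (Fin (e' + 1) → WeierstrassCurve.geomTorsion W (p : ℤ)) →ₗ[ZMod p]
      (Fin (e' + 1) → WeierstrassCurve.geomTorsion W (p : ℤ)) :=
    ((W.modPTwist p κ.invTwist (e' + 1) γ₀).toAddMonoidHom - AddMonoidHom.id _).toZModLinearMap p
  have hfix : ∀ x : Fin (e' + 1) → WeierstrassCurve.geomTorsion W (p : ℤ),
      (fun i => W.torsionGaloisModule (p : ℤ) γ₀ (x i)) = x := fun x =>
    funext fun i => by rw [WeierstrassCurve.torsionGaloisModule_apply_apply, hγ₀E]
  have hTapply : ∀ x, T x = W.modPTwist p κ (e' + 1) γ₀ x - fun i => W.torsionGaloisModule (p : ℤ) γ₀ (x i) :=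
    fun x => by rw [hfix]; rfl
  have hDapply : ∀ y, D y =
      W.modPTwist p κ.invTwist (e' + 1) γ₀ y - fun i => W.torsionGaloisModule (p : ℤ) γ₀ (y i) :=
    fun y => by rw [hfix]; rfl
  have hT0 : ∀ x, T x ⟨0, by omega⟩ = 0 := fun x => by
    rw [hTapply]; exact LevelE.twistModP_sub_apply_zero κ _ _ (e' + 1) hγ₀ (by omega) x
  have hT1 : ∀ x, T x ⟨1, he1⟩ = x ⟨0, by omega⟩ := fun x => by
    rw [hTapply]
    refine (LevelE.twistModP_sub_apply_one κ _ _ (e' + 1) hγ₀ he1 x).trans ?_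
    rw [WeierstrassCurve.torsionGaloisModule_apply_apply, hγ₀E]
  have hD0 : ∀ y, D y ⟨0, by omega⟩ = 0 := fun y => by
    rw [hDapply]; exact LevelE.invTwist_twistModP_sub_apply_zero κ _ _ (e' + 1) hγ₀ (by omega) y
  have hD1 : ∀ y, D y ⟨1, he1⟩ = -y ⟨0, by omega⟩ := fun y => by
    rw [hDapply]
    refine (LevelE.invTwist_twistModP_sub_apply_one κ _ _ (e' + 1) hγ₀ he1 y).trans ?_
    rw [WeierstrassCurve.torsionGaloisModule_apply_apply, hγ₀E]
  have hMkT : ∀ z ∈ Mk, (T z.1, D z.2) ∈ Mk := by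
    intro z hz
    rw [hMkmem] at hz ⊢
    have h1 := contOneCocycles.smul_mem_jointValueSubgroup φ ψ H hX hY γ₀ hz
    exact LevelE.sub_mem_of_prod_stable (W.modPTwist p κ (e' + 1) γ₀).toAddMonoidHom
      (W.modPTwist p κ.invTwist (e' + 1) γ₀).toAddMonoidHom Mj (fun w hw =>
        contOneCocycles.smul_mem_jointValueSubgroup φ ψ H hX hY γ₀ hw) hz
  have h1M : ∀ v : WeierstrassCurve.geomTorsion W (p : ℤ), ∃ z ∈ Mk, z.1 ⟨0, by omega⟩ = v := by
    intro v
    obtain ⟨z, hz, hz1⟩ := contOneCocycles.exists_mem_jointValueSubgroup_fst_eq φ ψ H hX hY hφtop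
      (fun i => if (i : ℕ) = 0 then v else 0)
    exact ⟨z, (hMkmem z).2 hz, by rw [hz1]; simp⟩
  have h2M : ∀ v : WeierstrassCurve.geomTorsion W (p : ℤ), ∃ z ∈ Mk, z.2 ⟨0, by omega⟩ = v := by
    intro v
    obtain ⟨z, hz, hz2⟩ := contOneCocycles.exists_mem_jointValueSubgroup_snd_eq φ ψ H hX hY hψtop
      (fun i => if (i : ℕ) = 0 then v else 0)
    exact ⟨z, (hMkmem z).2 hz, by rw [hz2]; simp⟩
  haveI : NeZero p := ⟨hp.ne_zero⟩
  set eWH := weilPairingHom W p eW hμ hadd₁ hadd₂ with heWH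
  set ι := muCarrierZModEquiv ℚ p with hι
  set evAdd : WeierstrassCurve.geomTorsion W (p : ℤ) →+ WeierstrassCurve.geomTorsion W (p : ℤ) →+ ZMod p :=
    eWH.flip.compr₂ ι.toAddMonoidHom with hevAdd
  let ev : WeierstrassCurve.geomTorsion W (p : ℤ) →ₗ[ZMod p]
      WeierstrassCurve.geomTorsion W (p : ℤ) →ₗ[ZMod p] ZMod p :=
    LinearMap.mk₂ (ZMod p) (fun y v => evAdd y v)
      (fun y₁ y₂ v => by rw [evAdd.map_add]; rfl)
      (fun c y v => ZMod.map_smul (evAdd.flip v) c y)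
      (fun y v₁ v₂ => (evAdd y).map_add v₁ v₂)
      (fun c y v => ZMod.map_smul (evAdd y) c v)
  have hev_apply : ∀ y v, ev y v = ι (eWH v y) := fun _ _ => rfl
  have hev : ∃ y v, ev y v ≠ 0 := by
    have hcard : 1 < Nat.card (WeierstrassCurve.geomTorsion W (p : ℤ)) := by
      rw [W.natCard_geomTorsion (n := (p : ℤ)) (by exact_mod_cast hp.ne_zero), Int.natAbs_natCast]
      nlinarith [hp.one_lt]
    haveI := Finite.one_lt_card_iff_nontrivial.mp hcard
    obtain ⟨T₀, hT₀⟩ := exists_ne (0 : WeierstrassCurve.geomTorsion W (p : ℤ))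
    have hS : ∃ S, eW S T₀ ≠ 1 := by
      by_contra h
      push Not at h
      exact hT₀ (hnondeg T₀ h)
    obtain ⟨S, hS⟩ := hS
    refine ⟨T₀, S, ?_⟩
    rw [hev_apply]
    intro h0
    apply hS
    have h1 : eWH S T₀ = 0 := ι.map_eq_zero_iff.mp h0
    rw [heWH, muCarrier_eq_iff, coe_weilPairingHom] at h1
    exact h1
  have h2k : (2 : ZMod p) ≠ 0 := by
    have h : ((2 : ℕ) : ZMod p) ≠ 0 := by
      rw [Ne, ZMod.natCast_eq_zero_iff]
      intro hdvd
      have := Nat.le_of_dvd two_pos hdvd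
      have := hp.two_le
      omega
    exact_mod_cast h
  obtain ⟨z, hzM, hz01⟩ := LevelE.exists_mem_pairingCoeff_ne_zero (e := e' + 1) h2k (by omega) ev hev T D
    hT0 hT1 hD0 hD1 Mk hMkT h1M h2M
  refine ⟨z, (hMkmem z).1 hzM, ?_⟩
  rw [hev_apply, hev_apply, hev_apply, ← map_add] at hz01
  rcases hz01 with h0 | h1
  · exact Or.inl fun h => h0 (by rw [h, map_zero])
  · exact Or.inr fun h => h1 (by rw [add_comm, h, map_zero])

end Summit.BirchSwinnertonDyer.BirchSwinnertonDyer.Rank1Residual.CoreAssembly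

end
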